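/-
Copyright (c) 2026 the pub-hodgecm-mathlib formalisation cell (harness21).  Prover seat hodgecm-mathlib-F0P2-p11 (g0) (L1 re-deal s1969∕s1970, LEAD F0P6-plan (g14)
EMIT #1 «p22» (R1-α)), Track B «K2-LIT» ∕ hLiu418 #184♮, ROAD Φ, G5-b = Φ7-3, organ (R1-α), device (b3-ii)(B) = THE HEAD OF (R1-α)(b): the middle term of a rank-one
coefficient in closed form (over ★ p861153, ★ p861210, ★ p861243, ★ p861293).  THEOREMS ONLY.
-/
import Summits.HodgeConjecture.HodgeConjecture.Theorems.K2LiuRankOneCornerOrbit   -- ★ p861293 (b3-ii)(A) (+ ★ p861243 (b3-i), ★ p861210 (b1)(b2′), ★ p861153 (b2), ★ criterion)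
import HarnessLib

/-!
# Crux `HLiu418`, ROAD Φ, organ Φ7-3 (R1-α)(b), THE HEAD: THE MIDDLE TERM OF A RANK-ONE FOURIER COEFFICIENT OF THE SIEGEL EISENSTEIN SERIES (`n = 2`) IS ONE
# CORNER-LINE INTEGRAL — `MID_S(h) = C · ∫_{𝔸_{L⁺}} conj ψ_S(Λĝ⁻¹ n₂(t) Λĝ) · f(w₀ n₂(t) Λĝ h) dμ(t)`, `ĝ = γ[w]`, for `S = u ⊗ w` `T_L`-skew

Cell `hodgecm-mathlib`, crux item hLiu418 = `stmt-HodgeConjecture-24832` (helper lane, count-neutral); squad K2 ∕ K2Liu, LEAD F0P6-plan (g14), desk (R1-α)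
K2E5-p17 (g8); prover F0P2-p11 (g0).  THEOREMS ONLY (no `def`, no `instance`, no notation, no named-fact hypothesis, no `sorry`).

THE STATEMENT (census K2E5-p17 (g7) `CENSUS-G5b-RankOneTermPackage` 4a4be154eb368c66 §0 (b) «`MID_S(f_s)(h) = c_β · W⁽¹⁾_μ(…)(m(p′_S) h)` — ONE surviving
`N_Δ(L⁺)`-orbit, NO Eisenstein sum»).  Datum of #41 (`n = 2`; `w₀ = ι(1, g₀ ⊗ 1)`, `Λ ∕ hΛ`, `Γ₀ = Stab([w₀])` with a covering weight `β₁`, big-cell representatives `wq`, all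
BY VALUE as on the whole of ROAD Φ); `νN` a Haar measure on `N_Δ(𝔸)` invariant under the Levi conjugations `u ↦ Λĝ u Λĝ⁻¹`, `g ∈ GL₂(L)` (BY VALUE, ★ α3-2's `hconj`); `μ` an
additive Haar measure on `𝔸_{L⁺}`.  **`exists_middle_cell_rankOne_eq_corner_integral`**: there are the corner one-parameter subgroup `n₂ : 𝔸_{L⁺} → N_Δ(𝔸)` and ONE
`C ∈ (0, ∞)` (those of ★ p861153 `exists_corner_unfold_of_invariant`) such that for every `N_Δ(L⁺)`-covering weight `β`, every continuous Siegel section `f` of `I_Δ(s, χ)`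
with the absolute-convergence hypothesis (H) at `h`, every RANK-ONE `T_L`-skew index `S = u ⊗ w` (`u, w ≠ 0`) and every row section `γ : ℙ(L²) → GL₂(L)`:
  `∫ β(u) • (conj ψ_S(u) · Σ_{q ∈ REST} f(γ_q (u h))) dνN(u) = C • ∫ conj ψ_S(Λĝ⁻¹ · n₂ t · Λĝ) · f(w₀ (n₂ t · (Λĝ h))) dμ(t)`,   `ĝ = (γ [w]) ⊗ 1`.
THE PROOF.  ★ p861243 `middle_cell_eq_tsum_twisted`: `MID_S = Σ_{p ∈ ℙ¹(L)} V_S(p)`; for `p ≠ [w]` the conjugated index `S^{Λ(γp)^}_𝔸` is NOT corner-supported (★ p861293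
`corner_levi_iff_mk_eq`, `[γ p₁] = p`), so the orbit dies (★ criterion `tsum_middle_orbit_eq_zero_of_ne_corner`, read back through ★ p861210 `tsum_orbit_reflStd_siegel_eq_twisted`)
and `MID_S = V_S([w])` (`tsum_eq_single`); at `p = [w]` the conjugated index IS corner-supported, the transported twist `conj ψ_S(Λĝ⁻¹ · Λĝ)` is left-`N_χ(𝔸)`-invariant
(★ p861210 `conj_unipDeltaChar_conj_invariant`) and ★ p861210 `exists_corner_unfold_char_section` unfolds `V_S([w])` along the corner line.
What is NOT here: (R1-α)(a) (the big cell `W_S`), and the reading of the corner-line integral as the rank-one Whittaker functional `W⁽¹⁾_μ` of the inner line (carrier «A»,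
(R1-γ) ∕ (T4)).
References: [KudlaRallis1994] §2 (2.10)–(2.12); [Shimura1997] §18.3–18.5, Thm. 18.14 (singular coefficients); [MoeglinWaldspurger1995] II.1.7; [Tan1999] §4;
[GelbartPiatetskishapiroRallis1987] Part A §2.
HONEST LABEL.  Count-neutral helper: `HC_CM` is proved only modulo the 7 printed citations (2 remaining named inputs: hLiu418 = `stmt-HodgeConjecture-24832`,
h413 = `stmt-HodgeConjecture-24833`) until rung 0 closes.
-/

set_option autoImplicit false
set_option linter.dupNamespace false -- the mandated namespace repeats `HodgeConjecture.HodgeConjecture`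

noncomputable section

open scoped Matrix ENNReal NNReal ComplexConjugate
open NumberField IsDedekindDomain MeasureTheory MeasureTheory.Measure Filter Set Function
open Literature.NumberTheory.Automorphic Literature.NumberTheory.Automorphic.UnitaryGroup Literature.NumberTheory.GaloisRepresentations
open Literature.NumberTheory.GelbartRogawski1991 Literature.NumberTheory.GelbartRogawski1991.GRConstruction
open Literature.NumberTheory.GelbartRogawski1991.AdaptedBlocks
open Literature.NumberTheory.K2Lit.SiegelDoubled Literature.MeasureTheory.Group
open UnitaryDualPair

namespace Summit.HodgeConjecture.HodgeConjecture.Cruxes.HLiu418.K2LiuRankOneMiddleTermCorner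

open K2LiuUnipotentCoveringWeight K2LiuSiegelUnipotentFourierDefs K2LiuSiegelUnipotentCharacters K2LiuSiegelEisensteinCoeffOrbitSum K2LiuSiegelBruhatMiddleCellDelta
  K2LiuSiegelRationalLeviDecomposition K2LiuSiegelMiddleCellSortedPattern K2LiuSiegelMiddleCellLeviCriterion K2LiuSiegelEisensteinCoeffOrbitCriterion
  K2LiuRankOneUnfolding K2LiuRankOneOrbitTransport K2LiuRankOneMiddleOrbitSum K2LiuRankOneCornerOrbit

variable {L : Type} [Field L] [NumberField L] [IsCMField L]

section Two

variable {N M : ℕ} {e : Fin N × Fin M ≃ Fin 2}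
  {dV : Fin N → L} {hdV : ∀ i, IsCMField.complexConj L (dV i) = dV i}
  {dW : Fin M → L} {hdW : ∀ i, IsCMField.complexConj L (dW i) = dW i}
variable [MeasurableSpace (unipDelta L e dV hdV dW hdW)] [BorelSpace (unipDelta L e dV hdV dW hdW)]

variable {g₀ : UnitaryGroup.rationalPair (Fp L) L (IsCMField.complexConj L) N M (Matrix.diagonal dV) (Matrix.diagonal dW)}
  (hg₀ : ((g₀ : GL (Fin N × Fin M) L) : Matrix (Fin N × Fin M) (Fin N × Fin M) L) = Matrix.diagonal (fun k => 1 - 2 * (![0, 1] : Fin 2 → L) (e k)))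
  (Λ : GL (Fin 2) (AdeleRing (𝓞 L) L) →* HA L e dV hdV dW hdW)
  (hΛ : ∀ g : GL (Fin 2) (AdeleRing (𝓞 L) L), blk L e dV hdV dW hdW (Λ g) =
    cayR (AdeleRing (𝓞 L) L) (Fin 2) * Matrix.fromBlocks (g : Matrix (Fin 2) (Fin 2) (AdeleRing (𝓞 L) L)) 0 0
      (((gramR L e dV hdV dW hdW).map ((algebraMap L (AdeleRing (𝓞 L) L)).comp (algebraMap (Fp L) L)))⁻¹ *
        (((g⁻¹ : GL (Fin 2) (AdeleRing (𝓞 L) L)) : Matrix (Fin 2) (Fin 2) (AdeleRing (𝓞 L) L)).map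
          (conjAdele (Fp L) L (IsCMField.complexConj L)))ᵀ *
        (gramR L e dV hdV dW hdW).map ((algebraMap L (AdeleRing (𝓞 L) L)).comp (algebraMap (Fp L) L))) *
      cayRinv (AdeleRing (𝓞 L) L) (Fin 2))
  (Γ₀ : Subgroup (unipDelta L e dV hdV dW hdW))
  (hΓ₀ : ∀ u : unipDelta L e dV hdV dW hdW, u ∈ Γ₀ ↔ (u : HA L e dV hdV dW hdW) ∈ ratH L e dV hdV dW hdW ∧
    IsSiegelDelta L e dV hdV dW hdW (iotaGG L e dV hdV dW hdW (1, UnitaryGroup.rationalPairToAdelic (Fp L) L (IsCMField.complexConj L) N M (Matrix.diagonal dV) (Matrix.diagonal dW) g₀) * (u : HA L e dV hdV dW hdW) * (iotaGG L e dV hdV dW hdW (1, UnitaryGroup.rationalPairToAdelic (Fp L) L (IsCMField.complexConj L) N M (Matrix.diagonal dV) (Matrix.diagonal dW) g₀))⁻¹))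
  (wq : unipDeltaRat L e dV hdV dW hdW → ratH L e dV hdV dW hdW)
  (hwq : ∀ ν, ((wq ν : ratH L e dV hdV dW hdW) : HA L e dV hdV dW hdW) =
    weylDelta L e dV hdV dW hdW * ((ν : unipDelta L e dV hdV dW hdW) : HA L e dV hdV dW hdW))

include hwq hg₀ hΛ hΓ₀ in
/-- **(R1-α)(b): THE MIDDLE TERM OF A RANK-ONE FOURIER COEFFICIENT IS ONE CORNER-LINE INTEGRAL.**  See the module docstring: with the corner one-parameter subgroup
`n₂` and the constant `C ∈ (0, ∞)` of ★ p861153, for every `N_Δ(L⁺)`-covering weight `β`, every `Γ₀`-covering weight `β₁`, every continuous Siegel section `f` of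
`I_Δ(s, χ)` with (H) at `h`, every rank-one `T_L`-skew `S = u ⊗ w` and every row section `γ`:
  `MID_S(h) = C • ∫ conj ψ_S(Λĝ⁻¹ · n₂ t · Λĝ) · f(w₀ (n₂ t · (Λĝ h))) dμ(t)`, `ĝ = (γ [w]) ⊗ 1`.
[cite: KudlaRallis1994, §2 (2.10)–(2.12)] [cite: Shimura1997, §18.3] [cite: MoeglinWaldspurger1995, II.1.7] [cite: Tan1999, §4] -/
theorem exists_middle_cell_rankOne_eq_corner_integral (hdV0 : ∀ i, dV i ≠ 0) (hdW0 : ∀ i, dW i ≠ 0)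
    (νN : Measure (unipDelta L e dV hdV dW hdW)) [IsHaarMeasure νN]
    [MeasurableSpace (AdeleRing (𝓞 (Fp L)) (Fp L))] [BorelSpace (AdeleRing (𝓞 (Fp L)) (Fp L))]
    (μ : Measure (AdeleRing (𝓞 (Fp L)) (Fp L))) [μ.IsAddHaarMeasure] :
    ∃ (n₂ : AdeleRing (𝓞 (Fp L)) (Fp L) → HA L e dV hdV dW hdW) (C : ℝ≥0∞), C ≠ 0 ∧ C ≠ ∞ ∧
      Continuous n₂ ∧ (∀ s t, n₂ (s + t) = n₂ s * n₂ t) ∧ (∀ t, n₂ t ∈ unipDelta L e dV hdV dW hdW) ∧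
      (∀ t, (blk L e dV hdV dW hdW (n₂ t)).toBlocks₁₂ =
        Matrix.single (1 : Fin 2) (1 : Fin 2) (AdeleRing.baseChange (Fp L) L t * algebraMap L (AdeleRing (𝓞 L) L) (imagUnit L))) ∧
      (∀ t : Fp L, n₂ (algebraMap (Fp L) (AdeleRing (𝓞 (Fp L)) (Fp L)) t) ∈ ratH L e dV hdV dW hdW) ∧
      ∀ {β₁ : unipDelta L e dV hdV dW hdW → ℝ≥0∞} (_ : IsCoveringWeight Γ₀ β₁)
        {β : unipDelta L e dV hdV dW hdW → ℝ≥0∞} (_ : IsCoveringWeight (unipDeltaRat L e dV hdV dW hdW) β)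
        {χ : HeckeCharacter L} {s : ℂ} {f : HA L e dV hdV dW hdW → ℂ} (_ : IsSiegelDeltaSection L e dV hdV dW hdW χ s f) (_ : Continuous f)
        (_ : ∀ g : GL (Fin 2) L, MeasurePreserving (fun u : unipDelta L e dV hdV dW hdW =>
          (⟨Λ (Matrix.GeneralLinearGroup.map (algebraMap L (AdeleRing (𝓞 L) L)) g) * (u : HA L e dV hdV dW hdW) *
              (Λ (Matrix.GeneralLinearGroup.map (algebraMap L (AdeleRing (𝓞 L) L)) g))⁻¹,
            conj_levi_mem_unipDelta L e dV hdV dW hdW Λ hΛ _ u.2⟩ : unipDelta L e dV hdV dW hdW)) νN νN)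
        {S : Matrix (Fin 2) (Fin 2) L}
        (_ : S ∈ skewMatrices ((IsCMField.complexConj L : L ≃ₐ[Fp L] L) : L →+* L) ((gramR L e dV hdV dW hdW).map (algebraMap (Fp L) L)))
        {u w : Fin 2 → L} (_ : S = Matrix.vecMulVec u w) (_ : u ≠ 0) (hw : w ≠ 0)
        (γ : Projectivization L (Fin 2 → L) → GL (Fin 2) L)
        (_ : ∀ p, Projectivization.mk L ((γ p : Matrix (Fin 2) (Fin 2) L) 1) (row_ne_zero (γ p) 1) = p)
        (h : HA L e dV hdV dW hdW)
        (_ : ∫⁻ u, (∑' q : SiegelDeltaQuot L e dV hdV dW hdW,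
          ‖f ((((Quotient.out q : ratH L e dV hdV dW hdW) : HA L e dV hdV dW hdW)) * ((u : HA L e dV hdV dW hdW) * h))‖ₑ) * β u ∂νN ≠ ∞),
        ∫ u, (β u).toReal • (conj (unipDeltaChar L e dV hdV dW hdW S (u : HA L e dV hdV dW hdW) : ℂ) *
            (∑' q : ↥(({Quotient.mk (MulAction.orbitRel (siegelDeltaRat L e dV hdV dW hdW) (ratH L e dV hdV dW hdW)) 1} ∪
              Set.range (fun ν : unipDeltaRat L e dV hdV dW hdW =>
                (Quotient.mk (MulAction.orbitRel (siegelDeltaRat L e dV hdV dW hdW) (ratH L e dV hdV dW hdW)) (wq ν) :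
                  SiegelDeltaQuot L e dV hdV dW hdW)))ᶜ : Set (SiegelDeltaQuot L e dV hdV dW hdW)),
            f ((((Quotient.out (q : SiegelDeltaQuot L e dV hdV dW hdW) : ratH L e dV hdV dW hdW) : HA L e dV hdV dW hdW)) *
              ((u : HA L e dV hdV dW hdW) * h)))) ∂νN =
          C.toReal • ∫ t, conj (unipDeltaChar L e dV hdV dW hdW S
              ((Λ (Matrix.GeneralLinearGroup.map (algebraMap L (AdeleRing (𝓞 L) L)) (γ (Projectivization.mk L w hw))))⁻¹ * n₂ t *
                Λ (Matrix.GeneralLinearGroup.map (algebraMap L (AdeleRing (𝓞 L) L)) (γ (Projectivization.mk L w hw)))) : ℂ) *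
            f (iotaGG L e dV hdV dW hdW (1, UnitaryGroup.rationalPairToAdelic (Fp L) L (IsCMField.complexConj L) N M (Matrix.diagonal dV) (Matrix.diagonal dW) g₀) *
              (n₂ t * (Λ (Matrix.GeneralLinearGroup.map (algebraMap L (AdeleRing (𝓞 L) L)) (γ (Projectivization.mk L w hw))) * h))) ∂μ := by
  obtain ⟨n₂, C, hC0, hCtop, hn₂c, hn₂add, hn₂mem, hn₂X, hn₂rat, hmain⟩ :=
    exists_corner_unfold_char_section (g₀ := g₀) hdV0 hdW0 hg₀ Λ hΛ νN μ
  refine ⟨n₂, C, hC0, hCtop, hn₂c, hn₂add, hn₂mem, hn₂X, hn₂rat, ?_⟩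
  intro β₁ hβ₁ β hβ χ s f hf hfc hconj S hS u w hS1 hu hw γ hγ h hH
  have hgg := mul_self_of_coe_eq_signDiagonal L e dV dW (pattern_std L) hg₀
  -- the `ℙ¹(L)`-indexed orbit sum (★ p861243)
  have hγ₀ : ∀ p : Projectivization L (Fin 2 → L),
      iotaGG L e dV hdV dW hdW (1, UnitaryGroup.rationalPairToAdelic (Fp L) L (IsCMField.complexConj L) N M (Matrix.diagonal dV) (Matrix.diagonal dW) g₀) *
        Λ (Matrix.GeneralLinearGroup.map (algebraMap L (AdeleRing (𝓞 L) L)) (γ p)) ∈ ratH L e dV hdV dW hdW := fun p =>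
    mul_mem (iotaGG_one_mem_ratH L e dV hdV dW hdW g₀) (levi_map_mem_ratH L e dV hdV dW hdW Λ hΛ hdV0 hdW0 (γ p))
  have hOp : ∀ p : Projectivization L (Fin 2 → L), ∫⁻ u, (∑' q : ↥(Set.range (fun ν : unipDeltaRat L e dV hdV dW hdW =>
        (Quotient.mk (MulAction.orbitRel (siegelDeltaRat L e dV hdV dW hdW) (ratH L e dV hdV dW hdW))
          ((⟨_, hγ₀ p⟩ : ratH L e dV hdV dW hdW) * ⟨((ν : unipDelta L e dV hdV dW hdW) : HA L e dV hdV dW hdW), coe_mem_ratH ν⟩)))),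
        ‖f (((Quotient.out q.1 : ratH L e dV hdV dW hdW) : HA L e dV hdV dW hdW) * ((u : HA L e dV hdV dW hdW) * h))‖ₑ) * β u ∂νN ≠ ∞ := by
    intro p
    refine ne_top_of_le_ne_top hH (lintegral_mono fun u => mul_le_mul' ?_ le_rfl)
    exact ENNReal.tsum_comp_le_tsum_of_injective Subtype.val_injective
      (fun q : SiegelDeltaQuot L e dV hdV dW hdW => ‖f ((((Quotient.out q : ratH L e dV hdV dW hdW) : HA L e dV hdV dW hdW)) * ((u : HA L e dV hdV dW hdW) * h))‖ₑ)
  obtain ⟨hsum, -⟩ := middle_cell_eq_tsum_twisted hg₀ Λ hΛ Γ₀ hΓ₀ wq hwq hdV0 hdW0 νN hβ hf hfc h hH hβ₁ hconj S γ hγ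
  rw [hsum, tsum_eq_single (Projectivization.mk L w hw)]
  · -- the surviving term `p = [w]`: the conjugated index is corner-supported, the transported twist is admissible, ★ p861210 §2 unfolds it
    have hcorner := (corner_levi_iff_mk_eq L e dV hdV dW hdW Λ hΛ hdV0 hdW0 hS hS1 hu hw (γ (Projectivization.mk L w hw))).2
      (hγ (Projectivization.mk L w hw)).symm
    exact (hmain Γ₀ hΓ₀ β₁ hβ₁ hf hfc
      (fun x => conj (unipDeltaChar L e dV hdV dW hdW S
        ((Λ (Matrix.GeneralLinearGroup.map (algebraMap L (AdeleRing (𝓞 L) L)) (γ (Projectivization.mk L w hw))))⁻¹ * x *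
          Λ (Matrix.GeneralLinearGroup.map (algebraMap L (AdeleRing (𝓞 L) L)) (γ (Projectivization.mk L w hw)))) : ℂ))
      ((Complex.continuous_conj.comp (continuous_unipDeltaChar L e dV hdV dW hdW S)).comp
        ((continuous_const.mul continuous_subtype_val).mul continuous_const))
      (fun z hz hzP x hx => conj_unipDeltaChar_conj_invariant hg₀ (isSiegelDelta_levi_apply L e dV hdV dW hdW Λ hΛ _) S hcorner hz hzP hx)
      (Λ (Matrix.GeneralLinearGroup.map (algebraMap L (AdeleRing (𝓞 L) L)) (γ (Projectivization.mk L w hw))) * h)).2.2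
  · -- the other terms die: off `[w]` the conjugated index is not corner-supported (★ p861293), the orbit sum vanishes (★ criterion), read through ★ p861210 §1
    intro p hp
    rw [← tsum_orbit_reflStd_siegel_eq_twisted Γ₀ hΓ₀ νN hβ hf hfc h hβ₁ (levi_map_mem_ratH L e dV hdV dW hdW Λ hΛ hdV0 hdW0 (γ p))
      (isSiegelDelta_levi_apply L e dV hdV dW hdW Λ hΛ _) (hconj (γ p)) S (hγ₀ p) (hOp p)]
    refine tsum_middle_orbit_eq_zero_of_ne_corner hdV0 hdW0 νN hβ hf hfc (pattern_std L) hg₀ hgg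
      (levi_map_mem_ratH L e dV hdV dW hdW Λ hΛ hdV0 hdW0 (γ p)) (isSiegelDelta_levi_apply L e dV hdV dW hdW Λ hΛ _) (hγ₀ p) h hS ?_ (hOp p)
    intro hc
    exact hp (((corner_levi_iff_mk_eq L e dV hdV dW hdW Λ hΛ hdV0 hdW0 hS hS1 hu hw (γ p)).1 hc).trans (hγ p)).symm

end Two

end Summit.HodgeConjecture.HodgeConjecture.Cruxes.HLiu418.K2LiuRankOneMiddleTermCorner

end
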